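import Mathlib.Analysis.Calculus.Deriv.Inv
import Mathlib.Analysis.Calculus.Deriv.Pow
import Literature.Geometry.Lorentzian.TeukolskyRealAxisModeStability
import HarnessLib

/-!
# Carter's radial coefficient in the blown-up horizon chart: Euler-zone size and the oscillatory pocket
(namespace `Literature.Geometry.Lorentzian.Kerr`.)

In the blown-up radius `x = (r − r₊)/d`, `d = r₊ − r₋`, the scalar (`s = 0`) radial Teukolsky /
Carter equation on sub-extremal Kerr takes the Liouville normal form `W″ = Q W` for
`W = √(x(x+1))·R`, with

  `Q(x) = (L·x(x+1) − k(x)² − ¼) / (x(x+1))²`,  `k(x) = K(r₊ + d x)/d = k₀ + ω x (2r₊ + d x)`,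

where `K = ω(r² + a²) − am` (`Kerr.radialK`), `L = Λ − 2amω` and `k₀ = K(r₊)/d = (ω − mω₊)/(2κ)`
(Teukolsky–Press 1974; the double pole at `x = 0` carries the near-horizon oscillation `x^{±ik₀}`).
This file records the ELEMENTARY POINTWISE facts about this explicit rational coefficient that
drive a priori transport estimates across the throat `θ ≤ x ≤ X₀` with constants polynomial in
`X₀/θ ≍ κ⁻¹`:

* `radialK_rPlus_add_mul_div` — the identity `K(r₊ + d x)/d = K(r₊)/d + ω x(2r₊ + d x)`;
* `throat_sq_mul_abs_coeff_le` — EULER-ZONE SIZE: for `x ≥ c|k₀|` (and `|L| ≤ L₀`,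
  `|ω(2r₊ + dx)| ≤ G`), `x²|Q(x)| ≤ L₀ + ¼ + 2/c² + 2G²` (an inverse-square coefficient, to be fed
  to `Literature.Analysis.ODE.norm_add_mul_norm_deriv_le_of_euler`);
* `throat_pocket_numerator_bounds` — OSCILLATORY POCKET: if `|x·ω(2r₊ + dx)| ≤ |k₀|/144` and
  `|L| x(x+1) ≤ k₀²/16` then `k² + ¼ − Lx(x+1) ≥ k₀²/4 + ¼ > 0` and `|k| ≤ 2|k₀|` (so `−Q > 0`:
  the pocket `x ≲ |k₀|` is classically allowed, uniformly in the size of `k₀`);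
* `hasDerivAt_throat_negCoeff` — the derivative of `P = −Q = (k² + ¼ − Lx(x+1))/(x(x+1))²`;
* `throat_negCoeff_deriv_numerator_nonpos` — on the pocket `x ≤ c|k₀|` with `cG ≤ 1/144`
  (`|k′| ≤ G`), the numerator of `P′` is `≤ 0`: `P` is NON-INCREASING, so the Sonin envelope
  `|W|² + |W′|²/P` is non-decreasing in `x` (`Literature.Analysis.ODE.norm_sq_le_soninEnvelope_of_ge`)
  and `|W|` is bounded on the pocket by its data at the pocket's outer end — with NO loss in `k₀`.

Everything is stated for real parameters `L k₀ ω r₊ d` (no sub-extremality is needed for the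
algebra) and proved by elementary inequalities; the transport itself is
`CarterThroatTransport.lean`.

## References
* S. A. Teukolsky, W. H. Press, *Perturbations of a rotating black hole. III*, Astrophys. J. 193
  (1974), 443–461, §II (the near-horizon variable `x` and the exponent `ik₀`).
* F. W. J. Olver, *Asymptotics and Special Functions* (1974), Ch. 6 (Liouville normal form,
  renormalisation at a double pole). Key `Olver1974`.
* M. Dafermos, I. Rodnianski, Y. Shlapentokh-Rothman, arXiv:1402.7034, §8 (the rôle of
  `ω − mω₊` near the horizon). Key `DafermosRodnianskiShlapentokhrothman2014`.
-/

noncomputable section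

open Set

namespace Literature.Geometry.Lorentzian

namespace Kerr

/-! ### The blown-up `K`: `K(r₊ + d x)/d = k₀ + ω x (2r₊ + d x)` -/

/-- `K(r₀ + d x)/d = K(r₀)/d + ω x (2r₀ + d x)` for `K = ω(r² + a²) − am` (`Kerr.radialK`) and any
`d ≠ 0` (in the application `r₀ = r₊`, `d = r₊ − r₋`, and `K(r₊)/d = (ω − mω₊)/(2κ)`). [folklore] -/
theorem radialK_add_mul_div (a ω m r₀ x : ℝ) {d : ℝ} (hd : d ≠ 0) :
    radialK a ω m (r₀ + d * x) / d = radialK a ω m r₀ / d + ω * x * (2 * r₀ + d * x) := by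
  unfold radialK
  field_simp
  ring

/-! ### Euler-zone size of the coefficient -/

/-- **Euler-zone size of Carter's blown-up coefficient.** For `0 < x` with `c|k₀| ≤ x` (`0 < c`),
`|L| ≤ L₀` and `|g| ≤ G` (in the application `g = ω(2r₊ + d x)`):
`x² · |(L x(x+1) − (k₀ + x g)² − ¼)/(x(x+1))²| ≤ L₀ + ¼ + 2/c² + 2G²`
(`|L|x/(x+1) ≤ L₀`, `(k₀ + xg)² ≤ 2k₀² + 2x²g² ≤ (2/c² + 2G²)(x+1)²`). [folklore] -/
theorem throat_sq_mul_abs_coeff_le {L k₀ g x c L₀ G : ℝ} (hx : 0 < x) (hc : 0 < c)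
    (hcx : c * |k₀| ≤ x) (hL : |L| ≤ L₀) (hg : |g| ≤ G) :
    x ^ 2 * |(L * (x * (x + 1)) - (k₀ + x * g) ^ 2 - 1 / 4) / (x * (x + 1)) ^ 2| ≤
      L₀ + 1 / 4 + 2 / c ^ 2 + 2 * G ^ 2 := by
  have hx1 : 0 < x + 1 := by linarith
  have hD : 0 < (x * (x + 1)) ^ 2 := by positivity
  rw [abs_div, abs_of_pos hD, mul_div_assoc', div_le_iff₀ hD]
  -- `|numerator| ≤ |L| x(x+1) + (k₀ + xg)² + 1/4`
  have hnum : |L * (x * (x + 1)) - (k₀ + x * g) ^ 2 - 1 / 4| ≤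
      |L| * (x * (x + 1)) + (k₀ + x * g) ^ 2 + 1 / 4 := by
    have h1 : |L * (x * (x + 1)) - (k₀ + x * g) ^ 2 - 1 / 4| ≤
        |L * (x * (x + 1)) - (k₀ + x * g) ^ 2| + |(1 / 4 : ℝ)| := abs_sub _ _
    have h2 : |L * (x * (x + 1)) - (k₀ + x * g) ^ 2| ≤ |L * (x * (x + 1))| + |(k₀ + x * g) ^ 2| :=
      abs_sub _ _
    rw [abs_mul, abs_of_pos (by positivity : 0 < x * (x + 1)),
      abs_of_nonneg (sq_nonneg (k₀ + x * g))] at h2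
    rw [abs_of_pos (by norm_num : (0 : ℝ) < 1 / 4)] at h1
    linarith
  -- the three pieces against `(x+1)²`
  have hk0 : k₀ ^ 2 ≤ x ^ 2 / c ^ 2 := by
    rw [le_div_iff₀ (by positivity)]
    have h0 : 0 ≤ c * |k₀| := by positivity
    nlinarith [sq_abs k₀, mul_self_le_mul_self h0 hcx]
  have hg2 : g ^ 2 ≤ G ^ 2 := by
    have := sq_abs g
    nlinarith [abs_nonneg g, sq_abs g]
  have hA : |L| * (x * (x + 1)) ≤ L₀ * (x + 1) ^ 2 := by
    have : |L| * (x * (x + 1)) ≤ L₀ * (x * (x + 1)) :=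
      mul_le_mul_of_nonneg_right hL (by positivity)
    have hL0 : 0 ≤ L₀ := (abs_nonneg L).trans hL
    nlinarith [mul_nonneg hL0 hx1.le]
  have hB : (k₀ + x * g) ^ 2 ≤ (2 / c ^ 2 + 2 * G ^ 2) * (x + 1) ^ 2 := by
    have h1 : (k₀ + x * g) ^ 2 ≤ 2 * k₀ ^ 2 + 2 * (x * g) ^ 2 := by
      nlinarith [sq_nonneg (k₀ - x * g)]
    have h2 : x ^ 2 ≤ (x + 1) ^ 2 := by nlinarith
    have h3 : 2 * k₀ ^ 2 ≤ 2 / c ^ 2 * (x + 1) ^ 2 := by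
      rw [div_mul_eq_mul_div, le_div_iff₀ (by positivity)]
      rw [le_div_iff₀ (by positivity)] at hk0
      nlinarith
    have h4 : 2 * (x * g) ^ 2 ≤ 2 * G ^ 2 * (x + 1) ^ 2 := by
      rw [mul_pow]
      nlinarith [mul_le_mul h2 hg2 (sq_nonneg g) (sq_nonneg _), sq_nonneg G]
    nlinarith
  have hC : (1 / 4 : ℝ) ≤ 1 / 4 * (x + 1) ^ 2 := by nlinarith
  calc x ^ 2 * |L * (x * (x + 1)) - (k₀ + x * g) ^ 2 - 1 / 4|
      ≤ x ^ 2 * (|L| * (x * (x + 1)) + (k₀ + x * g) ^ 2 + 1 / 4) :=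
        mul_le_mul_of_nonneg_left hnum (sq_nonneg x)
    _ ≤ x ^ 2 * (L₀ * (x + 1) ^ 2 + (2 / c ^ 2 + 2 * G ^ 2) * (x + 1) ^ 2 + 1 / 4 * (x + 1) ^ 2) := by
        gcongr
    _ = (L₀ + 1 / 4 + 2 / c ^ 2 + 2 * G ^ 2) * (x * (x + 1)) ^ 2 := by ring

/-! ### The oscillatory pocket: positivity of `−Q` -/

/-- **The pocket numerator is comparable to `k₀²`.** If `|t| ≤ |k₀|/144` and `|ℓ| ≤ k₀²/16` (in the
application `t = x·ω(2r₊ + dx)`, `ℓ = L x(x+1)`, valid for `x ≤ c|k₀|` with `c` small), then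
`k₀²/4 + ¼ ≤ (k₀ + t)² + ¼ − ℓ` and `|k₀ + t| ≤ 2|k₀|`. [folklore] -/
theorem throat_pocket_numerator_bounds {k₀ t ℓ : ℝ} (ht : |t| ≤ |k₀| / 144)
    (hℓ : |ℓ| ≤ k₀ ^ 2 / 16) :
    k₀ ^ 2 / 4 + 1 / 4 ≤ (k₀ + t) ^ 2 + 1 / 4 - ℓ ∧ |k₀ + t| ≤ 2 * |k₀| := by
  have hkt : |k₀ * t| ≤ k₀ ^ 2 / 144 := by
    rw [abs_mul]
    calc |k₀| * |t| ≤ |k₀| * (|k₀| / 144) := mul_le_mul_of_nonneg_left ht (abs_nonneg _)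
      _ = k₀ ^ 2 / 144 := by rw [← sq_abs k₀]; ring
  have h1 : -(k₀ ^ 2 / 144) ≤ k₀ * t := (neg_le_neg hkt).trans (neg_abs_le _)
  have h2 : -(k₀ ^ 2 / 16) ≤ -ℓ := neg_le_neg ((le_abs_self ℓ).trans hℓ)
  refine ⟨by nlinarith [sq_nonneg t], ?_⟩
  calc |k₀ + t| ≤ |k₀| + |t| := abs_add_le _ _
    _ ≤ |k₀| + |k₀| / 144 := by gcongr
    _ ≤ 2 * |k₀| := by linarith [abs_nonneg k₀]

/-! ### The oscillatory pocket: `−Q` is non-increasing -/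

/-- **Derivative of `P = −Q`** in the blown-up chart: for `x ≠ 0`, `x ≠ −1`, the function
`y ↦ ((k₀ + ω y (2r₊ + d y))² + ¼ − L y(y+1)) / (y(y+1))²` has derivative `(N′D − N D′)/D²` at `x`
with `N = k² + ¼ − Lx(x+1)`, `N′ = 2k·ω(2r₊ + 2dx) − L(2x+1)`, `D = (x(x+1))²`,
`D′ = 2x(x+1)(2x+1)`. [folklore] -/
theorem hasDerivAt_throat_negCoeff (L k₀ ω rp d : ℝ) {x : ℝ} (hx : x * (x + 1) ≠ 0) :
    HasDerivAt (fun y : ℝ ↦ ((k₀ + ω * y * (2 * rp + d * y)) ^ 2 + 1 / 4 - L * (y * (y + 1))) /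
        (y * (y + 1)) ^ 2)
      (((2 * (k₀ + ω * x * (2 * rp + d * x)) * (ω * (2 * rp + 2 * d * x)) - L * (2 * x + 1)) *
            (x * (x + 1)) ^ 2 -
          ((k₀ + ω * x * (2 * rp + d * x)) ^ 2 + 1 / 4 - L * (x * (x + 1))) *
            (2 * (x * (x + 1)) * (2 * x + 1))) /
        ((x * (x + 1)) ^ 2) ^ 2) x := by
  have hP : HasDerivAt (fun y : ℝ ↦ y * (y + 1)) (2 * x + 1) x :=
    ((hasDerivAt_id' x).fun_mul ((hasDerivAt_id' x).add_const 1)).congr_deriv (by ring)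
  have hk : HasDerivAt (fun y : ℝ ↦ k₀ + ω * y * (2 * rp + d * y)) (ω * (2 * rp + 2 * d * x)) x := by
    have h := (((hasDerivAt_id' x).const_mul ω).fun_mul
      (((hasDerivAt_id' x).const_mul d).const_add (2 * rp))).const_add k₀
    exact h.congr_deriv (by ring)
  have hN : HasDerivAt
      (fun y : ℝ ↦ (k₀ + ω * y * (2 * rp + d * y)) ^ 2 + 1 / 4 - L * (y * (y + 1)))
      (2 * (k₀ + ω * x * (2 * rp + d * x)) * (ω * (2 * rp + 2 * d * x)) - L * (2 * x + 1)) x := by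
    have h := ((hk.fun_pow 2).add_const (1 / 4)).sub (hP.const_mul L)
    refine h.congr_deriv ?_
    simp only [Nat.cast_ofNat, Nat.add_one_sub_one, pow_one]
  have hD : HasDerivAt (fun y : ℝ ↦ (y * (y + 1)) ^ 2) (2 * (x * (x + 1)) * (2 * x + 1)) x := by
    have h := hP.fun_pow 2
    refine h.congr_deriv ?_
    simp only [Nat.cast_ofNat, Nat.add_one_sub_one, pow_one]
  exact hN.div hD (pow_ne_zero 2 hx)

/-- **The numerator of `P′` is non-positive on the pocket.** Let `0 < x ≤ c|k₀|` with
`c·G ≤ 1/144`, `|k′| ≤ G`, `|k| ≤ 2|k₀|`, `|L| x(x+1) ≤ k₀²/16` and `k₀²/4 ≤ N` where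
`N = k² + ¼ − Lx(x+1)`. Then `(2k k′ − L(2x+1))·(x(x+1))² − N·2x(x+1)(2x+1) ≤ 0`
(`N′x(x+1) ≤ (4G|k₀|c|k₀| + k₀²/16)(2x+1) ≤ (13/144)k₀²(2x+1) ≤ 2N(2x+1)`). [folklore] -/
theorem throat_negCoeff_deriv_numerator_nonpos {L k₀ k k' x c G : ℝ} (hx : 0 < x)
    (hxc : x ≤ c * |k₀|) (hcG : c * G ≤ 1 / 144) (hk' : |k'| ≤ G) (hk : |k| ≤ 2 * |k₀|)
    (hL : |L| * (x * (x + 1)) ≤ k₀ ^ 2 / 16)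
    (hN : k₀ ^ 2 / 4 ≤ k ^ 2 + 1 / 4 - L * (x * (x + 1))) :
    (2 * k * k' - L * (2 * x + 1)) * (x * (x + 1)) ^ 2 -
        (k ^ 2 + 1 / 4 - L * (x * (x + 1))) * (2 * (x * (x + 1)) * (2 * x + 1)) ≤ 0 := by
  have hx1 : 0 < x + 1 := by linarith
  have hP : 0 < x * (x + 1) := by positivity
  -- it suffices to bound `N′ · x(x+1) ≤ 2N(2x+1)`
  suffices h : (2 * k * k' - L * (2 * x + 1)) * (x * (x + 1)) ≤
      2 * (k ^ 2 + 1 / 4 - L * (x * (x + 1))) * (2 * x + 1) by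
    nlinarith [mul_le_mul_of_nonneg_right h hP.le]
  have hG : 0 ≤ G := (abs_nonneg _).trans hk'
  -- `2 k k′ x(x+1) ≤ 4|k₀| G x (2x+1) ≤ (4/144) k₀² (2x+1)`
  have hkk : |k * k'| ≤ 2 * |k₀| * G := by
    rw [abs_mul]; exact mul_le_mul hk hk' (abs_nonneg _) (by positivity)
  have h1 : 2 * k * k' * (x * (x + 1)) ≤ 4 * |k₀| * G * (x * (2 * x + 1)) := by
    have h1a : k * k' ≤ 2 * |k₀| * G := (le_abs_self _).trans hkk
    have h1b : x * (x + 1) ≤ x * (2 * x + 1) := by nlinarith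
    have h0 : 0 ≤ 2 * |k₀| * G := by positivity
    nlinarith [mul_le_mul h1a h1b hP.le h0]
  have h2 : 4 * |k₀| * G * (x * (2 * x + 1)) ≤ k₀ ^ 2 / 36 * (2 * x + 1) := by
    -- `G x ≤ G c |k₀| ≤ |k₀|/144`
    have hGx : G * x ≤ |k₀| / 144 :=
      calc G * x ≤ G * (c * |k₀|) := mul_le_mul_of_nonneg_left hxc hG
        _ = c * G * |k₀| := by ring
        _ ≤ 1 / 144 * |k₀| := mul_le_mul_of_nonneg_right hcG (abs_nonneg _)
        _ = |k₀| / 144 := by ring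
    have h21 : 0 < 2 * x + 1 := by linarith
    have := mul_le_mul_of_nonneg_left hGx (by positivity : 0 ≤ 4 * |k₀| * (2 * x + 1))
    have e : k₀ ^ 2 = |k₀| ^ 2 := (sq_abs k₀).symm
    rw [e]
    nlinarith
  -- `−L(2x+1) x(x+1) ≤ (k₀²/16)(2x+1)`
  have h3 : -(L * (2 * x + 1)) * (x * (x + 1)) ≤ k₀ ^ 2 / 16 * (2 * x + 1) := by
    have : -L * (x * (x + 1)) ≤ k₀ ^ 2 / 16 := by
      have := (neg_le_abs L).trans (le_abs_self |L|)
      rw [abs_abs] at this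
      nlinarith
    nlinarith
  nlinarith

end Kerr

end Literature.Geometry.Lorentzian

end
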